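import Mathlib
import Summits.Langlands.Langlands.Theses.ParityBlindBianchi

/-!
# Sketch — crux idea `hermitian-wall-patching` (crux stmt-Langlands-15111, R′ = `ArtinWeightRealisationLevel`;
# equally crux stmt-Langlands-11057 R and the route's even core R″ = `ArtinWeightRealisationEven`, stmt-Langlands-16619)

Ideator planner-cruxidea-stmt-Langlands-15111-5-0 (round 2, k = 5), 2026-08-17.

The line proposed on the card replaces "classicality at the Artin wall" by COMMUTATIVE ALGEBRA: Calegari–Geraghty /
BCGP patching of the (ordinary, cuspidal) coherent complex of the U(2,2) Shimura variety at scalar weight 2, localised at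
the Siegel–Eisenstein maximal ideal of σ̄, whose reducible locus is the Artin-weight deformation ring of σ̄ over K.
The HINGE of that engine is the elementary fact below: a prime 𝔭 in the support of a finitely generated module M has a
NON-ZERO eigen-quotient M/𝔭M (so a characteristic-zero point x̃ : R → 𝒪 lying in Supp_R(M patched / 𝔞) is the Hecke
eigensystem of a non-zero class in the classical module).  We record it kernel-checked, together with the numerology
δ = dim(GL₄/B) − dim(GL₄/P_(2,2)) = 6 − 4 = 2 that fixes the length (δ + 1 = 3) of the complex to patch.
-/

set_option linter.dupNamespace false

namespace Summit.Langlands.Langlands.Cruxes.ArtinWeightRealisationLevel.HermitianWallPatching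

/-- SUPPORT ⇒ NON-ZERO EIGEN-QUOTIENT (the hinge of the Calegari–Geraghty support argument).
If `𝔭 ∈ Supp_R M` for a finitely generated `R`-module `M`, then `𝔭 M ≠ M`. Proof: Nakayama + `Supp M = V(Ann M)`. -/
theorem smul_top_ne_top_of_mem_support {R M : Type*} [CommRing R] [AddCommGroup M] [Module R M]
    [Module.Finite R M] {𝔭 : PrimeSpectrum R} (h : 𝔭 ∈ Module.support R M) :
    𝔭.asIdeal • (⊤ : Submodule R M) ≠ ⊤ := by
  intro htop
  have hle : (⊤ : Submodule R M) ≤ 𝔭.asIdeal • ⊤ := htop.ge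
  obtain ⟨r, hr1, hr0⟩ :=
    Submodule.exists_sub_one_mem_and_smul_eq_zero_of_fg_of_le_smul 𝔭.asIdeal ⊤ Module.Finite.fg_top hle
  have hr : r ∈ Module.annihilator R M := Module.mem_annihilator.2 fun m => hr0 m trivial
  have hrp : r ∈ 𝔭.asIdeal := Module.mem_support_iff_of_finite.1 h hr
  have h1 : (1 : R) ∈ 𝔭.asIdeal := by
    have := 𝔭.asIdeal.sub_mem hrp hr1
    simpa using this
  exact 𝔭.isPrime.ne_top ((Ideal.eq_top_iff_one _).2 h1)

/-- The eigen-quotient `M ⧸ 𝔭M` at a prime of the support is a non-trivial `R ⧸ 𝔭`-module: read with `R` = the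
polarized deformation ring, `M` = (dual of) the patched classical coherent cohomology and `𝔭 = ker (x̃ : R → 𝒪)` the
Artin–Eisenstein point, this is "a classical weight-2 Hermitian eigenclass with eigensystem ℰ(σψ) exists". -/
theorem nontrivial_eigenQuotient_of_mem_support {R M : Type*} [CommRing R] [AddCommGroup M] [Module R M]
    [Module.Finite R M] {𝔭 : PrimeSpectrum R} (h : 𝔭 ∈ Module.support R M) :
    Nontrivial (M ⧸ 𝔭.asIdeal • (⊤ : Submodule R M)) :=
  Submodule.Quotient.nontrivial_iff.mpr (smul_top_ne_top_of_mem_support h)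

/-- Conversely the whole point of PATCHING is to put the point in the support: if `Ann_R M = ⊥` (e.g. `M` faithful,
which Calegari–Geraghty obtain from "maximal Cohen–Macaulay over a domain of the same dimension"), every prime is in
the support. -/
theorem mem_support_of_annihilator_eq_bot {R M : Type*} [CommRing R] [AddCommGroup M] [Module R M]
    [Module.Finite R M] (hM : Module.annihilator R M = ⊥) (𝔭 : PrimeSpectrum R) :
    𝔭 ∈ Module.support R M :=
  Module.mem_support_iff_of_finite.2 (hM ▸ bot_le)

/-- NUMEROLOGY of the wall (card §Why it bites): a p-adic Hodge type of GL_n with weight multiplicities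
`m₁,…,m_r` cuts the crystalline local deformation ring down, relative to the regular case, by
δ = dim G/B − dim G/P_μ = Σ mᵢ(mᵢ−1)/2 (one unit per coincident pair of Hodge–Tate weights).  Weight one over ℚ:
type {0,0}, δ = 1, and Calegari–Geraghty patch the 2-term complex RΓ(X, ω) (H⁰, H¹).  The Siegel–Eisenstein point of an
Artin σ on U(2,2): type {0,0,1,1}, δ = 2, so the complex to patch must have exactly δ + 1 = 3 terms — the card's
checkable prediction for the ordinary cuspidal coherent complex of S̃ at scalar weight 2 (degrees 0,1,2). -/
def wallDefect (ms : List ℕ) : ℕ := (ms.map fun m => m * (m - 1) / 2).sum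

theorem wallDefect_weightOne : wallDefect [2] = 1 := by decide

theorem wallDefect_U22 : wallDefect [2, 2] = 2 := by decide

theorem wallDefect_regular : wallDefect [1, 1, 1, 1] = 0 := by decide

/-- Symplectic twin (GSp₄, weight (2,2), BCGP): dim Sp₄/B = 4, Lagrangian Grassmannian dim 3, δ = 1, 2 terms. -/
theorem wallDefect_GSp4 : (4 : ℕ) - 3 = 1 := by decide

/-- Bookkeeping for the Transfer (card §Transfer): the line reaches the route's EVEN core R″ and, through the landed
kit, R′ on the polarizable sector; R′ itself implies R″ (pure specialisation, in the tree as
`…Theorems.ParityBlindBianchiArtinWeightRealisationEvenOfLevel`).  We only record the shape of the composition the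
crux-plan skeleton will have: `stub_residualWall → stub_patching → stub_exit → R″`. -/
theorem even_of_stubs (ResidualWall Patching Exit : Prop)
    (compose : ResidualWall → Patching → Exit →
      Summit.Langlands.Langlands.Theses.ParityBlindBianchi.ArtinWeightRealisationEven)
    (h₁ : ResidualWall) (h₂ : Patching) (h₃ : Exit) :
    Summit.Langlands.Langlands.Theses.ParityBlindBianchi.ArtinWeightRealisationEven :=
  compose h₁ h₂ h₃


/-! ## Card `mod-two-maass-lift-seed`: the two parity-blindness facts at p = 2 it rests on -/

/-- The Maass-lift coefficient weights `d^{k-1}` are independent of `k ≥ 2` modulo 2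
(`d^j ≡ d (mod 2)` for `j ≥ 1`): the formal Hermitian Maass lifts of weights 2, 4, 6, … of congruent
inputs have congruent Fourier expansions mod 2. -/
theorem pow_mod_two_eq (d : ℕ) {j : ℕ} (hj : 1 ≤ j) : d ^ j % 2 = d % 2 := by
  rw [Nat.pow_mod]
  rcases Nat.mod_two_eq_zero_or_one d with h | h
  · simp [h, zero_pow (by omega : j ≠ 0)]
  · simp [h]

/-- The nebentypus `χ_K` (values ±1) required of Maass-lift inputs is invisible mod 2, so a mod-2
eigenform of trivial character is a candidate input. -/
theorem quadChar_mod_two (a : ℤ) (ha : a = 1 ∨ a = -1) : (a : ZMod 2) = 1 := by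
  rcases ha with rfl | rfl <;> decide

end Summit.Langlands.Langlands.Cruxes.ArtinWeightRealisationLevel.HermitianWallPatching
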